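import Literature.Geometry.PolyhedralFans.MultiStarSubdivision
import Literature.Geometry.PolyhedralFans.RelativeProjectiveRefinementTight
import HarnessLib

/-!
# Tools for the synchronised subdivision of a family of linked fans (KKMS II §2 by charts)

Topic: `Literature/Geometry/PolyhedralFans` (block A5 of the LINKED-KKMS programme, summit
`ResolutionOfSingularities`, W8.1 / Kato (10.4) atlas form). G. Kempf, F. Knudsen, D. Mumford,
B. Saint-Donat, *Toroidal Embeddings I* (LNM 339, 1973), Ch. II §2: the subdivision procedure of
Ch. I §2 Thm. 11 is run on ALL charts of a conical polyhedral complex at once. When the charts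
are finitely many fans `Δ i ⊆ ℚ^{n i}`, "at once" needs ONE constant in the multi-point Lemma 2
for all members, and ONE pair of normalising constants at the end; this file supplies these
uniform versions of tree lemmas (`Fan.IsOrdFunction.multiStar`, res-type-037;
`Fan.exists_regular_refinement_isStrictSupport_cones`, res-type-043):

* `Fan.IsOrdFunction.multiStar_bound` — the multi-point Lemma 2 with an explicit threshold:
  some `B > 0` such that EVERY `M ≥ B` works (so a family takes the maximum of its thresholds);
* `Fan.starIter_cones_eq_filter` — star subdivisions at points outside the support do nothing:
  `Δ.starIter l` and `Δ.starIter (l.filter (· ∈ |Δ|))` have the same cones;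
* `Fan.starCoord_eq_zero_of_not_mem_cone` — for a cone `σ` of the coarse fan covered by the
  cones of `Δ` inside it, `x ∈ σ`, `z ∉ σ` ⇒ `starCoord_z x = 0`;
* `Fan.family_tight_packaging` — **uniform packaging for a family**: from order functions
  `f i` of `Δ' i` over `Δ₀ i` (all `i`), ONE rational `c > 0` such that every `c · f i` is, on
  every cone of `Δ₀ i`, the minimum function of integral tight strict support data non-negative
  on the cone (verbatim the per-cone conclusion of
  `Fan.exists_regular_refinement_isStrictSupport_cones`), the SAME `c` for all members — so that
  value-compatibility `f j ∘ E = f i` along links survives the normalisation.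

References: [KempfEtAl1973] Ch. I §2 Thm. 11 (proof, Lemma 2 and step (2)), Ch. II §2;
[Fulton1993Toric] §2.6.
-/

noncomputable section

namespace Literature.Geometry.PolyhedralFans

open PointedCone Finset

namespace Fan

/-! ## The multi-point Lemma 2 with an explicit threshold -/

section Bound

variable {𝕜 : Type*} [Field 𝕜] [LinearOrder 𝕜] [IsStrictOrderedRing 𝕜]
variable {κ : Type*} [Fintype κ]

/-- **Multi-point Lemma 2, threshold form**: if `f` is an order function for the subdivision `Δ`
of `Δ₀` and `Z` is a finite set of nonzero vectors separated by `Δ`, there is `B > 0` such that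
for EVERY `M ≥ B` the function `M f + Σ_{z ∈ Z} starCoord_z` is an order function for the
simultaneous star subdivision through `Z` (any duplicate-free enumeration). (Same proof as
`IsOrdFunction.multiStar`, keeping the threshold.) [cite: KempfEtAl1973, I §2 Thm. 11 proof, Lemma 2] -/
theorem IsOrdFunction.multiStar_bound {Δ₀ Δ : Fan 𝕜 (κ → 𝕜)} {f : (κ → 𝕜) → 𝕜}
    (h : IsOrdFunction Δ₀ Δ f) {Z : Finset (κ → 𝕜)} (hZ0 : ∀ z ∈ Z, z ≠ 0)
    (hsep : ∀ σ ∈ Δ.cones, ∀ z ∈ Z, ∀ z' ∈ Z, z ∈ σ → z' ∈ σ → z = z') :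
    ∃ B : 𝕜, 0 < B ∧ ∀ M : 𝕜, B ≤ M → ∀ l : List (κ → 𝕜), l.Nodup → (∀ z, z ∈ l ↔ z ∈ Z) →
      IsOrdFunction Δ₀ (Δ.starIter l) fun x => M * f x + ∑ z ∈ Z, Δ.starCoord z x := by
  classical
  choose D hDf hsub using h
  have hsepσ : ∀ {σ} (hσ : σ ∈ Δ₀.cones), ∀ η ∈ (Δ.restrict σ).cones, ∀ z ∈ Z, ∀ z' ∈ Z,
      z ∈ η → z' ∈ η → z = z' := fun hσ η hη => hsep η hη.1
  have hB : ∀ {σ} (hσ : σ ∈ Δ₀.cones), ∃ B : 𝕜, 0 < B ∧ ∀ M : 𝕜, B ≤ M →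
      ∀ l : List (κ → 𝕜), l.Nodup → (∀ z, z ∈ l ↔ z ∈ Z) →
        ∃ D' : ((Δ.restrict σ).starIter l).SupportData,
          D'.f = fun x => M * (D hσ).f x + ∑ z ∈ Z, (Δ.restrict σ).starCoord z x :=
    fun hσ => (D hσ).exists_multiStar hZ0 (hsepσ hσ)
  set T := Δ₀.finite.toFinset with hT
  have hmemT : ∀ {σ}, σ ∈ Δ₀.cones → σ ∈ T := fun hσ => Δ₀.finite.mem_toFinset.mpr hσ
  have hTmem : ∀ {σ}, σ ∈ T → σ ∈ Δ₀.cones := fun hσ => Δ₀.finite.mem_toFinset.mp hσ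
  have hB' : ∀ s : T, ∃ B : 𝕜, 0 < B ∧ ∀ M : 𝕜, B ≤ M →
      ∀ l : List (κ → 𝕜), l.Nodup → (∀ z, z ∈ l ↔ z ∈ Z) →
        ∃ D' : ((Δ.restrict (s : PointedCone 𝕜 (κ → 𝕜))).starIter l).SupportData,
          D'.f = fun x => M * (D (hTmem s.2)).f x +
            ∑ z ∈ Z, (Δ.restrict (s : PointedCone 𝕜 (κ → 𝕜))).starCoord z x :=
    fun s => hB (hTmem s.2)
  choose Bσ hBσpos hBσ using hB'
  set B : 𝕜 := 1 + ∑ s ∈ T.attach, Bσ s with hBdef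
  have hBnn : ∀ s ∈ T.attach, 0 ≤ Bσ s := fun s _ => (hBσpos s).le
  have hBpos : 0 < B := by
    have := Finset.sum_nonneg hBnn
    rw [hBdef]; linarith
  have hbig : ∀ {σ} (hσ : σ ∈ Δ₀.cones), Bσ ⟨σ, hmemT hσ⟩ ≤ B := by
    intro σ hσ
    have h1 : Bσ ⟨σ, hmemT hσ⟩ ≤ ∑ s ∈ T.attach, Bσ s :=
      Finset.single_le_sum hBnn (Finset.mem_attach _ _)
    rw [hBdef]; linarith
  refine ⟨B, hBpos, fun M hM l hl hlZ σ hσ => ?_⟩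
  have hl0 : ∀ z ∈ l, z ≠ 0 := fun z hz => hZ0 z ((hlZ z).1 hz)
  obtain ⟨D', hD'f⟩ := hBσ ⟨σ, hmemT hσ⟩ M ((hbig hσ).trans hM) l hl hlZ
  have hcones : ((Δ.starIter l).restrict σ).cones = ((Δ.restrict σ).starIter l).cones :=
    restrict_starIter_cones l hl0 (hsub hσ)
  have hsuppσ : ((Δ.restrict σ).starIter l).support = (Δ.restrict σ).support :=
    starIter_support_eq l hl0
  have hsupp : ((Δ.starIter l).restrict σ).support = (Δ.restrict σ).support := by
    rw [support_congr hcones, hsuppσ]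
  refine ⟨(D'.copy hcones).copyF (fun x => M * f x + ∑ z ∈ Z, Δ.starCoord z x) fun x hx => ?_,
    rfl, ?_⟩
  · rw [hsupp] at hx
    rw [SupportData.copy_f, hD'f, hDf hσ]
    simp only
    congr 1
    exact Finset.sum_congr rfl fun z hz => (starCoord_restrict_eq (hZ0 z hz) hx).symm
  · rw [hsupp]; exact hsub hσ

end Bound

/-! ## Star subdivisions at points off the support -/

section Filter

variable {𝕜 : Type*} [Field 𝕜] [LinearOrder 𝕜] [IsStrictOrderedRing 𝕜]
variable {κ : Type*} [Fintype κ]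

/-- **Points outside the support do nothing**: the iterated star subdivision through `l` has the
same cones as that through the sublist of points in the support ([Fulton1993Toric] §2.6: the
star subdivision through `v` only changes the cones containing `v`). [cite: Fulton1993Toric, §2.6 p. 47] -/
theorem starIter_cones_eq_filter :
    ∀ (l : List (κ → 𝕜)) {Δ : Fan 𝕜 (κ → 𝕜)} (S : Set (κ → 𝕜)) [DecidablePred (· ∈ S)],
      (∀ z ∈ l, z ≠ 0) → Δ.support = S →
      (Δ.starIter l).cones = (Δ.starIter (l.filter fun z => z ∈ S)).cones
  | [], _, _, _, _, _ => rfl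
  | z :: l, Δ, S, _, hl, hS => by
    have hz0 : z ≠ 0 := hl z List.mem_cons_self
    have hl' : ∀ w ∈ l, w ≠ 0 := fun w hw => hl w (List.mem_cons_of_mem z hw)
    rw [starIter_cons, List.filter_cons]
    by_cases hz : z ∈ S
    · rw [decide_eq_true hz, if_pos rfl, starIter_cons]
      have hS' : (Δ.starSubdivision z).support = S := by
        rw [starSubdivision_support hz0, hS]
      exact starIter_cones_eq_filter l S hl' hS'
    · rw [decide_eq_false hz]
      simp only [Bool.false_eq_true, ↓reduceIte]
      have hzs : z ∉ Δ.support := by rw [hS]; exact hz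
      have hcones : (Δ.starSubdivision z).cones = Δ.cones := starSubdivision_cones_of_not_mem_support hzs
      have hS' : (Δ.starSubdivision z).support = S := by rw [support_congr hcones, hS]
      rw [starIter_cones_eq_filter l S hl' hS']
      exact starIter_cones_congr _ hcones

omit [Fintype κ] in
/-- `starCoord_z x = 0` for `x` in a cone `σ` of the coarse fan which is covered by the cones of
`Δ` inside it, when `z ∉ σ`. [cite: KempfEtAl1973, I §2 Thm. 11 proof, Lemma 2 (b)] -/
theorem starCoord_eq_zero_of_not_mem_cone {Δ : Fan 𝕜 (κ → 𝕜)} {σ : PointedCone 𝕜 (κ → 𝕜)}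
    (hsub : (σ : Set (κ → 𝕜)) ⊆ (Δ.restrict σ).support) {x z : κ → 𝕜} (hx : x ∈ σ) (hz : z ∉ σ) :
    Δ.starCoord z x = 0 := by
  obtain ⟨η, hη, hxη⟩ := mem_support.mp (hsub hx)
  exact starCoord_of_not_mem hη.1 (fun h => hz (hη.2 h)) hxη

end Filter

/-! ## Uniform packaging for a family -/

section Packaging

variable {ι : Type*} [Fintype ι] {n : ι → ℕ}

/-- **Uniform packaging of order functions over a family** ([KempfEtAl1973] I §2 Thm. 11, proof
(2) — "multiply `f` by a suitable integer" — done with ONE constant for a whole family of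
fans): given order functions `f i ≥ 0` of subdivisions `Δ' i` of `Δ₀ i`, there is one rational
`c > 0` such that for every member `i` and every cone `σ` of `Δ₀ i`, the cones of `Δ' i` inside
`σ` cover `σ` and carry integral tight strict support data, non-negative on `σ`, with minimum
function `c · f i`. [cite: KempfEtAl1973, I §2 Thm. 11 proof (2)] -/
theorem family_tight_packaging (Δ₀ Δ' : ∀ i, Fan ℚ (Fin (n i) → ℚ)) (f : ∀ i, (Fin (n i) → ℚ) → ℚ)
    (hord : ∀ i, IsOrdFunction (Δ₀ i) (Δ' i) (f i)) (hnn : ∀ i x, 0 ≤ f i x) :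
    ∃ c : ℚ, 0 < c ∧ ∀ i, ∀ ⦃σ : PointedCone ℚ (Fin (n i) → ℚ)⦄, σ ∈ (Δ₀ i).cones →
      ((Δ' i).restrict σ).support = (σ : Set (Fin (n i) → ℚ)) ∧
      ∃ m : PointedCone ℚ (Fin (n i) → ℚ) → (Fin (n i) → ℚ),
        ((Δ' i).restrict σ).IsStrictSupport m ∧
        ∀ τ ∈ ((Δ' i).restrict σ).cones,
          m τ ∈ latticeN (Fin (n i)) ∧ (∀ x ∈ σ, 0 ≤ m τ ⬝ᵥ x) ∧
            (∀ x ∈ τ, m τ ⬝ᵥ x = c * f i x) := by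
  classical
  -- support data per member and cone
  have h' : ∀ i, ∀ ⦃σ : PointedCone ℚ (Fin (n i) → ℚ)⦄, σ ∈ (Δ₀ i).cones →
      ∃ D : ((Δ' i).restrict σ).SupportData, D.f = f i ∧
        (σ : Set (Fin (n i) → ℚ)) ⊆ ((Δ' i).restrict σ).support := fun i => hord i
  choose D hDf hsub using h'
  -- the index set of all (member, cone) pairs
  let T : ∀ i, Finset (PointedCone ℚ (Fin (n i) → ℚ)) := fun i => (Δ₀ i).finite.toFinset
  have hTmem : ∀ {i} {σ : PointedCone ℚ (Fin (n i) → ℚ)}, σ ∈ T i → σ ∈ (Δ₀ i).cones :=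
    fun {i} {σ} hσ => (Δ₀ i).finite.mem_toFinset.mp hσ
  have hmemT : ∀ {i} {σ : PointedCone ℚ (Fin (n i) → ℚ)}, σ ∈ (Δ₀ i).cones → σ ∈ T i :=
    fun {i} {σ} hσ => (Δ₀ i).finite.mem_toFinset.mpr hσ
  let J : Finset (Σ i, PointedCone ℚ (Fin (n i) → ℚ)) := Finset.univ.sigma T
  have hJ : ∀ {i σ}, σ ∈ (Δ₀ i).cones → (⟨i, σ⟩ : Σ i, PointedCone ℚ (Fin (n i) → ℚ)) ∈ J :=
    fun hσ => Finset.mem_sigma.2 ⟨Finset.mem_univ _, hmemT hσ⟩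
  -- (1) one integer making all pieces integral
  choose N hN hNint using fun (p : J) =>
    (D p.1.1 (hTmem (Finset.mem_sigma.1 p.2).2)).exists_scale_integral
  set N₀ : ℕ := ∏ p ∈ J.attach, N p with hN₀
  have hN₀pos : 0 < N₀ := Finset.prod_pos fun p _ => hN p
  -- (2) one natural constant above all `tightM` of the scaled data
  let Ds : ∀ i ⦃σ⦄ (hσ : σ ∈ (Δ₀ i).cones), ((Δ' i).restrict σ).SupportData := fun i σ hσ =>
    (D i hσ).scale N₀ (by exact_mod_cast hN₀pos)
  set B : J → ℚ := fun p => (Ds p.1.1 (hTmem (Finset.mem_sigma.1 p.2).2)).tightM with hB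
  have hBnn : ∀ p ∈ J.attach, 0 ≤ B p := fun p _ => (SupportData.tightM_pos _).le
  set M₀ : ℚ := 1 + ∑ p ∈ J.attach, B p with hM₀
  set M : ℕ := ⌈M₀⌉₊ with hM
  have hM₀M : M₀ ≤ (M : ℚ) := Nat.le_ceil M₀
  have hMpos : 0 < (M : ℚ) := by
    have := Finset.sum_nonneg hBnn
    have : (0 : ℚ) < M₀ := by rw [hM₀]; linarith
    linarith
  have hbig : ∀ {i σ} (hσ : σ ∈ (Δ₀ i).cones), (Ds i hσ).tightM ≤ (M : ℚ) := by
    intro i σ hσ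
    have h1 : B ⟨⟨i, σ⟩, hJ hσ⟩ ≤ ∑ p ∈ J.attach, B p :=
      Finset.single_le_sum hBnn (Finset.mem_attach _ _)
    have h2 : B ⟨⟨i, σ⟩, hJ hσ⟩ = (Ds i hσ).tightM := rfl
    rw [← h2]; linarith
  -- (3) one integer clearing the denominators of all tight pieces
  let mt : ∀ i ⦃σ⦄ (hσ : σ ∈ (Δ₀ i).cones), PointedCone ℚ (Fin (n i) → ℚ) → (Fin (n i) → ℚ) :=
    fun i σ hσ ρ => (M : ℚ) • (Ds i hσ).piece ρ + (Ds i hσ).tightExpose ρ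
  choose Nt hNt hNtint using fun (p : J) =>
    Fan.exists_nat_smul_integral ((Δ' p.1.1).restrict p.1.2) (mt p.1.1 (hTmem (Finset.mem_sigma.1 p.2).2))
  set P : ℕ := ∏ p ∈ J.attach, Nt p with hP
  have hPpos : 0 < P := Finset.prod_pos fun p _ => hNt p
  have hPpos' : (0 : ℚ) < P := by exact_mod_cast hPpos
  -- the constant
  refine ⟨(P : ℚ) * ((M : ℚ) * (N₀ : ℚ)), mul_pos hPpos' (mul_pos hMpos (by exact_mod_cast hN₀pos)),
    fun i σ hσ => ⟨le_antisymm (restrict_support_subset σ) (hsub i hσ), ?_⟩⟩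
  have hstrict : ((Δ' i).restrict σ).IsStrictSupport (mt i hσ) :=
    (Ds i hσ).isStrictSupport_tight_of_le (hbig hσ)
  have hDsf : (Ds i hσ).f = fun x => (N₀ : ℚ) * f i x := by
    show ((D i hσ).scale N₀ _).f = _
    rw [SupportData.scale_f, hDf i hσ]
  refine ⟨fun ρ => (P : ℚ) • mt i hσ ρ, hstrict.smul hPpos', fun τ hτ => ⟨?_, fun x hx => ?_,
    fun x hx => ?_⟩⟩
  · -- integrality
    have hdvd : Nt ⟨⟨i, σ⟩, hJ hσ⟩ ∣ P :=
      Finset.dvd_prod_of_mem (fun p : J => Nt p) (Finset.mem_attach J ⟨⟨i, σ⟩, hJ hσ⟩)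
    obtain ⟨k, hk⟩ := hdvd
    show ((P : ℚ) • mt i hσ τ) ∈ latticeN (Fin (n i))
    rw [hk, Nat.cast_mul, mul_comm, mul_smul]
    have := intCast_smul_mem_latticeN (hNtint ⟨⟨i, σ⟩, hJ hσ⟩ τ hτ) (k : ℤ)
    rwa [Int.cast_natCast] at this
  · -- non-negativity on `σ`
    have hxs : x ∈ ((Δ' i).restrict σ).support := hsub i hσ hx
    have h1 := ((Ds i hσ).tight_global_of_le (hbig hσ) hτ hxs).1
    rw [hDsf] at h1
    show 0 ≤ ((P : ℚ) • mt i hσ τ) ⬝ᵥ x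
    rw [smul_dotProduct, smul_eq_mul]
    refine mul_nonneg hPpos'.le (le_trans ?_ h1)
    exact mul_nonneg (Nat.cast_nonneg M) (mul_nonneg (Nat.cast_nonneg N₀) (hnn i x))
  · -- the minimum function
    show ((P : ℚ) • mt i hσ τ) ⬝ᵥ x = _
    rw [smul_dotProduct, smul_eq_mul]
    show (P : ℚ) * (((M : ℚ) • (Ds i hσ).piece τ + (Ds i hσ).tightExpose τ) ⬝ᵥ x) = _
    rw [(Ds i hσ).tight_of_const_eq hτ hx, hDsf]
    simp only
    ring

end Packaging

end Fan

end Literature.Geometry.PolyhedralFans
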